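import Literature.AlgebraicGeometry.ModuliOfAbelianVarieties.SiegelFamilyRealPointsGammaTwoM
import HarnessLib

/-!
# Goresky–Tai's Lemma 7 — `H¹(ℂ/ℝ, Γ(4m)) ≅ Γ(4m)\Γ_{2m}(2)/Γ_ℓ(2)` via `β ↦ τ(β)β⁻¹`, elementwise —
# and LEMMA 12 (two components `g₁iC_n`, `g₂iC_n` joined by a `γ ∈ Γ(4m)` differ by `Γ_ℓ(2)`: `g₂ = γg₁α`)
# (Goresky–Tai 2003, §2.2, §4.1 Lemma 7 with its proof §4.2, §4.5 Lemma 12)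

Topic `Literature/AlgebraicGeometry/ModuliOfAbelianVarieties` (the Siegel-family files, namespace
`Literature.AlgebraicGeometry.ModuliOfAbelianVarieties.SiegelModuli`).  Lane `lit-hodgefound` (Track 2
foundations library), prover seat p15 generation 52, row g52-#5, on top of g52-#4 `SiegelFamilyRealPointsGammaTwoM`
(Lemma 9 (3) and its converse, Cor. 11 as printed), g52-#1 (Prop. 1: cocycles have real points), g51-#5
(`𝔥_g^{τ(h)h⁻¹} = h · iC_g`, `ι(KηK) = τ(ιη)`), the tree's free action of `Γ_g(q)`, `q ≥ 3`
(`SiegelFamilyPrincipalLevelFreeAction`) and `τ`-stability of `Γ_g(q)` (`SiegelFamilyRealPointsLevelTwo`).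
THEOREMS ONLY: no definition, no instance, no notation, no named fact (net Literature debt `0`), no `sorry`.
As in g52-#4, `Γ_{2m}(2)` is spelled out as the four block congruences `A ≡ D ≡ I (mod 2)`, `B ≡ C ≡ 0 (mod 2m)`,
and `Γ_ℓ(2) ↪ Sp` as the block-diagonal symplectic matrices `(P 0; 0 Q)` (automatically `ᵗPQ = I`, i.e.
`Q = ᵗP⁻¹`, `P ∈ GL(g, ℤ)`) with `P ≡ Q ≡ I (mod 2)`; `τ` on `Sp_{2g}(ℤ)` is `g ↦ KgK`, `K = (−1 0; 0 1)`.

## Source, VERBATIM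

M. Goresky, Y. S. Tai, *The moduli space of real abelian varieties with level structure*, Compositio
Math. **139** (2003) = arXiv:math/0108103, held `paper:arxiv-math_0108103`.  §2.2 p0004: «`τ` is an involution
of `G`, i.e. `τ(gh⁻¹) = τ(g)(τ(h))⁻¹`», «`τ(g) = g ⟺ g ∈ GL(n, ℝ)`».  §4.1 p0007: «`Γ_{2m}(2) = {(A B; C D) ∈ Γ |
A, D ≡ I (mod 2), B, C ≡ 0 (mod 2m)}`», «`Γ_ℓ(N) = {γ ∈ Γ_ℓ(1) | γ ≡ I (mod N)}`», «(The analogous construction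
of `Γ_m(2)` does not yield a group unless `m` is even.)», «**Lemma 7.** The short exact sequence
`1 → Γ(4m) → Γ_{2m}(2) → Γ(4m)\Γ_{2m}(2) → 1` induces a bijection `H¹(ℂ/ℝ, Γ(4m)) ≅ Γ(4m)\Γ_{2m}(2)/Γ_ℓ(2)`.
4.2 Proof.  We claim that `H¹(ℂ/ℝ, Γ(4m)) → H¹(ℂ/ℝ, Γ_{2m}(2))` is trivial.  For if `γ ∈ Γ(4m)` and if `f_γ` is
a 1-cocycle then by Proposition 6 (below), `𝔥_n^γ ≠ ∅`.  Then Proposition 11 implies that `γ = g̃g⁻¹` for some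
`g ∈ Γ_{2m}(2)`, which proves the claim.  Next, observe that `Gal(ℂ/ℝ)` acts trivially on the quotient group
`Γ(4m)\Γ_{2m}(2)`.  (For if `g ∈ Γ_{2m}(2)` then `g − g̃ ≡ 0 mod 4m` so `g̃g⁻¹ ≡ I mod 4m`.)  Therefore the long
exact cohomology sequence … is `H⁰(Γ(4m)) → H⁰(Γ_{2m}(2)) → H⁰(Γ(4m)\Γ_{2m}(2)) → H¹(Γ(4m)) → 1` with
`H⁰(Γ(4m)) = Γ_ℓ(4m)`, `H⁰(Γ_{2m}(2)) = Γ_ℓ(2)`.»  §4.5 p0008: «**Lemma 12.** Let `g₁, g₂ ∈ Γ_{2m}(2)`.  Suppose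
there exist `Z₁ ∈ g₁iC_n`, `Z₂ ∈ g₂iC_n`, and `γ ∈ Γ(4m)` such that `γZ₁ = Z₂`.  Then there exist `α ∈ Γ_ℓ(2)`
such that `g₂ = γg₁α`.  4.5 Proof.  By section 2.2 (3) we have a commutative diagram … so the element
`θ = g₁g̃₁⁻¹γ̃⁻¹g̃₂g₂⁻¹γ` fixes `Z₁`.  By lemma 9, `θ ∈ Γ(4m)` which is torsion-free.  So `θ = I`, which implies
`γ = g₂g̃₂⁻¹γ̃g̃₁g₁⁻¹`.  Therefore, `τ(g₂⁻¹γg₁) = g₂⁻¹γg₁` which implies that `g₂⁻¹γg₁ ∈ GL_n(ℝ) ∩ Γ_{2m}(2) =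
Γ_ℓ(2)`.»

## What is proved

* §1 `τ` on `Sp_{2g}(ℤ)`: **`conjK_mk_mul`**, **`conjK_mk_inv`** (`τ(ab) = τ(a)τ(b)`, `τ(a⁻¹) = τ(a)⁻¹`, from
  `K² = 1`), `conjK_mul_mul_conjK_eq_self_iff` (`τ(x) = x ⟺ x₁₂ = x₂₁ = 0` for INTEGRAL `x`),
  `fromBlocks_zero_zero_mem_symplecticGroup_iff` (`(P 0; 0 Q) ∈ Sp ⟺ ᵗPQ = 1`),
  `conjK_mk_mul_inv_eq_conjK_mk_mul_inv_iff` (`τ(a)a⁻¹ = τ(b)b⁻¹ ⟺ τ(b⁻¹a) = b⁻¹a`).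
* §2 `Γ_{2m}(2)` is a group containing `Γ(2m) ⊇ Γ(4m)` («does not yield a group unless `m` is even» — here the
  index is `2m`): **`gammaTwoM_toBlocks_mul`**,
  **`gammaTwoM_toBlocks_inv`**, **`gammaTwoM_toBlocks_of_mem_siegelPrincipalGamma`**.
* §3 LEMMA 7, elementwise, for the class map `β ↦ τ(β)β⁻¹`, `Γ_{2m}(2) → Z¹ = {γ ∈ Γ(4m) : τ(γ)γ = 1}` (values in
  `Γ(4m)` by Lemma 9 (3), g52-#4): **`conjK_mk_mul_inv_of_mul_mul`** (`τ(δβu)(δβu)⁻¹ = τ(δ)·τ(β)β⁻¹·δ⁻¹` for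
  block-diagonal `u`: constant on double cosets `Γ(4m)βΓ_ℓ(2)` up to `Γ(4m)`-coboundaries),
  **`exists_eq_mul_mul_fromBlocks_of_conjK_mk_mul_inv_eq`** (INJECTIVITY: `β, β′ ∈ Γ_{2m}(2)`, `δ ∈ Γ(4m)` with
  `τ(β′)β′⁻¹ = τ(δ)·τ(β)β⁻¹·δ⁻¹ ⟹ β′ = δβα`, `α ∈ Γ_ℓ(2)` — «`GL_n ∩ Γ_{2m}(2) = Γ_ℓ(2)`»),
  **`exists_gammaTwoM_eq_conjK_mul_inv_of_conjK_mul_self_eq_one`** (SURJECTIVITY, `g ≥ 1`, `m ≥ 1`: every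
  cocycle `γ ∈ Γ(4m)`, `τ(γ)γ = 1`, is `τ(β)β⁻¹` with `β ∈ Γ_{2m}(2)` — «`H¹(ℂ/ℝ, Γ(4m)) → H¹(ℂ/ℝ, Γ_{2m}(2))` is
  trivial», via Prop. 1 (g52-#1) and Cor. 11 (g52-#4)).
* §4 **`exists_eq_mul_mul_fromBlocks_of_smul_eq`** — LEMMA 12 as printed (`m ≥ 1`): `g₁, g₂ ∈ Γ_{2m}(2)`,
  `Z_i ∈ g_i · iC_g` (`Re(g_i⁻¹ • Z_i) = 0`), `γ ∈ Γ(4m)`, `γZ₁ = Z₂ ⟹ g₂ = γg₁α` with `α = (P 0; 0 Q)`, `ᵗPQ = 1`,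
  `P ≡ Q ≡ I (mod 2)`.

## References

* [GoreskyTai2003RealModuli] M. Goresky, Y. S. Tai, Compositio Math. 139 (2003) 1–27 (arXiv:math/0108103),
  §2.2, §4.1 Lemma 7, §4.2, §4.3 Lemma 9, §4.5 Lemma 12.
* [Brown1982CohomologyGroups] K. S. Brown, *Cohomology of Groups*, GTM 87, Ch. III §1 / Ch. IV §2 Ex. (non-abelian
  `H¹` of a group of order two: cocycles `aτ(a) = 1` modulo `a ∼ b·a·τ(b)⁻¹`).
-/

noncomputable section

open scoped Matrix ComplexConjugate
open Matrix Function

namespace Literature.AlgebraicGeometry.ModuliOfAbelianVarieties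

namespace SiegelModuli

open Literature.NumberTheory.Automorphic (siegelUpperHalfSpace)
open Literature.NumberTheory.ModularForms.SiegelUpperHalfSpace (symplecticIntHom siegelModularGroup
  symplecticIntHom_injective)
open Literature.NumberTheory.ModularForms.SiegelModularForm (siegelPrincipalGamma mem_siegelPrincipalGamma_iff
  siegelPrincipalGamma_anti)

variable {g : ℕ}

/-! ## §1 `τ(g) = KgK` on `Sp_{2g}(ℤ)`: multiplicative, involutive; `τ(x) = x ⟺ x ∈ GL(g)` -/

/-- **`τ(ab) = τ(a)τ(b)` in `Sp_{2g}(ℤ)`** (`K² = 1`). [cite: GoreskyTai2003RealModuli, §2.2 («`τ` is an involution of `G`, i.e. `τ(gh⁻¹) = τ(g)(τ(h))⁻¹`»)] -/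
theorem conjK_mk_mul (a b : Matrix.symplecticGroup (Fin g) ℤ) :
    (⟨Matrix.fromBlocks (-1 : Matrix (Fin g) (Fin g) ℤ) 0 0 (1 : Matrix (Fin g) (Fin g) ℤ) *
          ((a * b : Matrix.symplecticGroup (Fin g) ℤ) : Matrix (Fin g ⊕ Fin g) (Fin g ⊕ Fin g) ℤ) *
          Matrix.fromBlocks (-1 : Matrix (Fin g) (Fin g) ℤ) 0 0 (1 : Matrix (Fin g) (Fin g) ℤ),
        iStar_mul_mul_iStar_mem_symplecticGroup (a * b).2⟩ : Matrix.symplecticGroup (Fin g) ℤ) =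
      (⟨Matrix.fromBlocks (-1 : Matrix (Fin g) (Fin g) ℤ) 0 0 (1 : Matrix (Fin g) (Fin g) ℤ) *
            (a : Matrix (Fin g ⊕ Fin g) (Fin g ⊕ Fin g) ℤ) *
            Matrix.fromBlocks (-1 : Matrix (Fin g) (Fin g) ℤ) 0 0 (1 : Matrix (Fin g) (Fin g) ℤ),
          iStar_mul_mul_iStar_mem_symplecticGroup a.2⟩ : Matrix.symplecticGroup (Fin g) ℤ) *
        ⟨Matrix.fromBlocks (-1 : Matrix (Fin g) (Fin g) ℤ) 0 0 (1 : Matrix (Fin g) (Fin g) ℤ) *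
            (b : Matrix (Fin g ⊕ Fin g) (Fin g ⊕ Fin g) ℤ) *
            Matrix.fromBlocks (-1 : Matrix (Fin g) (Fin g) ℤ) 0 0 (1 : Matrix (Fin g) (Fin g) ℤ),
          iStar_mul_mul_iStar_mem_symplecticGroup b.2⟩ := by
  apply Subtype.ext
  change Matrix.fromBlocks (-1 : Matrix (Fin g) (Fin g) ℤ) 0 0 (1 : Matrix (Fin g) (Fin g) ℤ) *
        ((a : Matrix (Fin g ⊕ Fin g) (Fin g ⊕ Fin g) ℤ) * (b : Matrix (Fin g ⊕ Fin g) (Fin g ⊕ Fin g) ℤ)) *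
        Matrix.fromBlocks (-1 : Matrix (Fin g) (Fin g) ℤ) 0 0 (1 : Matrix (Fin g) (Fin g) ℤ) =
      Matrix.fromBlocks (-1 : Matrix (Fin g) (Fin g) ℤ) 0 0 (1 : Matrix (Fin g) (Fin g) ℤ) *
          (a : Matrix (Fin g ⊕ Fin g) (Fin g ⊕ Fin g) ℤ) *
          Matrix.fromBlocks (-1 : Matrix (Fin g) (Fin g) ℤ) 0 0 (1 : Matrix (Fin g) (Fin g) ℤ) *
        (Matrix.fromBlocks (-1 : Matrix (Fin g) (Fin g) ℤ) 0 0 (1 : Matrix (Fin g) (Fin g) ℤ) *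
            (b : Matrix (Fin g ⊕ Fin g) (Fin g ⊕ Fin g) ℤ) *
            Matrix.fromBlocks (-1 : Matrix (Fin g) (Fin g) ℤ) 0 0 (1 : Matrix (Fin g) (Fin g) ℤ))
  calc Matrix.fromBlocks (-1 : Matrix (Fin g) (Fin g) ℤ) 0 0 (1 : Matrix (Fin g) (Fin g) ℤ) *
        ((a : Matrix (Fin g ⊕ Fin g) (Fin g ⊕ Fin g) ℤ) * (b : Matrix (Fin g ⊕ Fin g) (Fin g ⊕ Fin g) ℤ)) *
        Matrix.fromBlocks (-1 : Matrix (Fin g) (Fin g) ℤ) 0 0 (1 : Matrix (Fin g) (Fin g) ℤ)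
      = Matrix.fromBlocks (-1 : Matrix (Fin g) (Fin g) ℤ) 0 0 (1 : Matrix (Fin g) (Fin g) ℤ) *
          (a : Matrix (Fin g ⊕ Fin g) (Fin g ⊕ Fin g) ℤ) *
          (Matrix.fromBlocks (-1 : Matrix (Fin g) (Fin g) ℤ) 0 0 (1 : Matrix (Fin g) (Fin g) ℤ) *
            Matrix.fromBlocks (-1 : Matrix (Fin g) (Fin g) ℤ) 0 0 (1 : Matrix (Fin g) (Fin g) ℤ)) *
          (b : Matrix (Fin g ⊕ Fin g) (Fin g ⊕ Fin g) ℤ) *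
          Matrix.fromBlocks (-1 : Matrix (Fin g) (Fin g) ℤ) 0 0 (1 : Matrix (Fin g) (Fin g) ℤ) := by
        rw [iStar_mul_iStar, Matrix.mul_one, ← Matrix.mul_assoc]
    _ = _ := by simp only [Matrix.mul_assoc]

/-- **`τ(a⁻¹) = τ(a)⁻¹` in `Sp_{2g}(ℤ)`.** [cite: GoreskyTai2003RealModuli, §2.2 («`τ(gh⁻¹) = τ(g)(τ(h))⁻¹`»)] -/
theorem conjK_mk_inv (a : Matrix.symplecticGroup (Fin g) ℤ) :
    (⟨Matrix.fromBlocks (-1 : Matrix (Fin g) (Fin g) ℤ) 0 0 (1 : Matrix (Fin g) (Fin g) ℤ) *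
          ((a⁻¹ : Matrix.symplecticGroup (Fin g) ℤ) : Matrix (Fin g ⊕ Fin g) (Fin g ⊕ Fin g) ℤ) *
          Matrix.fromBlocks (-1 : Matrix (Fin g) (Fin g) ℤ) 0 0 (1 : Matrix (Fin g) (Fin g) ℤ),
        iStar_mul_mul_iStar_mem_symplecticGroup (a⁻¹).2⟩ : Matrix.symplecticGroup (Fin g) ℤ) =
      (⟨Matrix.fromBlocks (-1 : Matrix (Fin g) (Fin g) ℤ) 0 0 (1 : Matrix (Fin g) (Fin g) ℤ) *
            (a : Matrix (Fin g ⊕ Fin g) (Fin g ⊕ Fin g) ℤ) *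
            Matrix.fromBlocks (-1 : Matrix (Fin g) (Fin g) ℤ) 0 0 (1 : Matrix (Fin g) (Fin g) ℤ),
          iStar_mul_mul_iStar_mem_symplecticGroup a.2⟩ : Matrix.symplecticGroup (Fin g) ℤ)⁻¹ := by
  apply eq_inv_of_mul_eq_one_left
  rw [← conjK_mk_mul, Subtype.ext_iff]
  change Matrix.fromBlocks (-1 : Matrix (Fin g) (Fin g) ℤ) 0 0 (1 : Matrix (Fin g) (Fin g) ℤ) *
        ((a⁻¹ * a : Matrix.symplecticGroup (Fin g) ℤ) : Matrix (Fin g ⊕ Fin g) (Fin g ⊕ Fin g) ℤ) *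
        Matrix.fromBlocks (-1 : Matrix (Fin g) (Fin g) ℤ) 0 0 (1 : Matrix (Fin g) (Fin g) ℤ) =
      ((1 : Matrix.symplecticGroup (Fin g) ℤ) : Matrix (Fin g ⊕ Fin g) (Fin g ⊕ Fin g) ℤ)
  rw [inv_mul_cancel]
  change Matrix.fromBlocks (-1 : Matrix (Fin g) (Fin g) ℤ) 0 0 (1 : Matrix (Fin g) (Fin g) ℤ) *
        (1 : Matrix (Fin g ⊕ Fin g) (Fin g ⊕ Fin g) ℤ) *
        Matrix.fromBlocks (-1 : Matrix (Fin g) (Fin g) ℤ) 0 0 (1 : Matrix (Fin g) (Fin g) ℤ) = 1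
  rw [Matrix.mul_one, iStar_mul_iStar]

/-- `−B = B ⟺ B = 0` for an integral matrix. [folklore] -/
private theorem neg_eq_self_iff_g52e {m n : Type*} (B : Matrix m n ℤ) : -B = B ↔ B = 0 := by
  constructor
  · intro h
    ext i j
    have hij := congr_fun (congr_fun h i) j
    rw [Matrix.neg_apply] at hij
    rw [Matrix.zero_apply]
    omega
  · rintro rfl
    exact neg_zero

/-- **«`τ(g) = g ⟺ g ∈ GL(n)`» for INTEGRAL matrices**: `KxK = x` iff the off-diagonal blocks of `x` vanish
(for symplectic `x` the diagonal blocks are then `(P, ᵗP⁻¹)`, `P ∈ GL(g, ℤ)`; the real case is g50-#7).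
[cite: GoreskyTai2003RealModuli, §2.2 («`τ(g) = g ⟺ g ∈ GL(n, ℝ)`») and §4.5 («`g₂⁻¹γg₁ ∈ GL_n(ℝ) ∩ Γ_{2m}(2) = Γ_ℓ(2)`»)] -/
theorem conjK_mul_mul_conjK_eq_self_iff (x : Matrix (Fin g ⊕ Fin g) (Fin g ⊕ Fin g) ℤ) :
    Matrix.fromBlocks (-1 : Matrix (Fin g) (Fin g) ℤ) 0 0 (1 : Matrix (Fin g) (Fin g) ℤ) * x *
        Matrix.fromBlocks (-1 : Matrix (Fin g) (Fin g) ℤ) 0 0 (1 : Matrix (Fin g) (Fin g) ℤ) = x ↔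
      x.toBlocks₁₂ = 0 ∧ x.toBlocks₂₁ = 0 := by
  conv_lhs => rw [← Matrix.fromBlocks_toBlocks x, iStar_mul_fromBlocks_mul_iStar, Matrix.fromBlocks_inj]
  rw [neg_eq_self_iff_g52e, neg_eq_self_iff_g52e]
  exact ⟨fun h ↦ ⟨h.2.1, h.2.2.1⟩, fun h ↦ ⟨rfl, h.1, h.2, rfl⟩⟩

/-- **`(P 0; 0 Q) ∈ Sp_{2g} ⟺ ᵗPQ = 1`** (so the block-diagonal part of `Sp_{2g}(R)` is `GL(g, R)`, `A ↦ (A 0; 0 ᵗA⁻¹)`).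
[cite: GoreskyTai2003RealModuli, §2.1 («Identify `GL(n, ℝ) ↪ Sp` with its image under the embedding `A ↦ (A 0; 0 ᵗA⁻¹)`»)] -/
theorem fromBlocks_zero_zero_mem_symplecticGroup_iff {R : Type*} [CommRing R] (P Q : Matrix (Fin g) (Fin g) R) :
    Matrix.fromBlocks P 0 0 Q ∈ Matrix.symplecticGroup (Fin g) R ↔ Pᵀ * Q = 1 := by
  rw [SymplecticGroup.fromBlocks_mem_iff]
  simp

/-- **«If `γ = g̃g⁻¹ = g̃′(g′)⁻¹` then `τ` fixes `(g′)⁻¹g`», integrally**: `τ(a)a⁻¹ = τ(b)b⁻¹ ⟺ τ(b⁻¹a) = b⁻¹a`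
in `Sp_{2g}(ℤ)` (the real case is in `SiegelFamilyPrincipalLevelFreeAction`).
[cite: GoreskyTai2003RealModuli, §3.8 and §4.5 («`τ(g₂⁻¹γg₁) = g₂⁻¹γg₁`»)] -/
theorem conjK_mk_mul_inv_eq_conjK_mk_mul_inv_iff (a b : Matrix.symplecticGroup (Fin g) ℤ) :
    (⟨Matrix.fromBlocks (-1 : Matrix (Fin g) (Fin g) ℤ) 0 0 (1 : Matrix (Fin g) (Fin g) ℤ) *
            (a : Matrix (Fin g ⊕ Fin g) (Fin g ⊕ Fin g) ℤ) *
            Matrix.fromBlocks (-1 : Matrix (Fin g) (Fin g) ℤ) 0 0 (1 : Matrix (Fin g) (Fin g) ℤ),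
          iStar_mul_mul_iStar_mem_symplecticGroup a.2⟩ : Matrix.symplecticGroup (Fin g) ℤ) * a⁻¹ =
        (⟨Matrix.fromBlocks (-1 : Matrix (Fin g) (Fin g) ℤ) 0 0 (1 : Matrix (Fin g) (Fin g) ℤ) *
              (b : Matrix (Fin g ⊕ Fin g) (Fin g ⊕ Fin g) ℤ) *
              Matrix.fromBlocks (-1 : Matrix (Fin g) (Fin g) ℤ) 0 0 (1 : Matrix (Fin g) (Fin g) ℤ),
            iStar_mul_mul_iStar_mem_symplecticGroup b.2⟩ : Matrix.symplecticGroup (Fin g) ℤ) * b⁻¹ ↔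
      (⟨Matrix.fromBlocks (-1 : Matrix (Fin g) (Fin g) ℤ) 0 0 (1 : Matrix (Fin g) (Fin g) ℤ) *
            ((b⁻¹ * a : Matrix.symplecticGroup (Fin g) ℤ) : Matrix (Fin g ⊕ Fin g) (Fin g ⊕ Fin g) ℤ) *
            Matrix.fromBlocks (-1 : Matrix (Fin g) (Fin g) ℤ) 0 0 (1 : Matrix (Fin g) (Fin g) ℤ),
          iStar_mul_mul_iStar_mem_symplecticGroup (b⁻¹ * a).2⟩ : Matrix.symplecticGroup (Fin g) ℤ) = b⁻¹ * a := by
  rw [conjK_mk_mul, conjK_mk_inv]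
  constructor
  · intro h
    have h' := mul_inv_eq_iff_eq_mul.1 h
    rw [h']
    group
  · intro h
    have h' := inv_mul_eq_iff_eq_mul.1 h
    rw [h']
    group

/-! ## §2 `Γ_{2m}(2)` is a group containing `Γ(2m)` (hence `Γ(4m)`) -/

/-- Reduction `mod q` followed by `ℤ/q → ℤ/d` (`d ∣ q`) is reduction `mod d`. [folklore] -/
private theorem map_intCast_zmod_of_dvd_g52e {d q : ℕ} (h : d ∣ q) (X : Matrix (Fin g) (Fin g) ℤ) :
    X.map (Int.castRingHom (ZMod d)) = (X.map (Int.castRingHom (ZMod q))).map (ZMod.castHom h (ZMod d)) := by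
  rw [Matrix.map_map]
  congr 1
  funext x
  simp

/-- `X ≡ 1 (mod q) ⟹ X ≡ 1 (mod d)` for `d ∣ q`. [folklore] -/
private theorem map_eq_one_of_dvd_g52e {d q : ℕ} (h : d ∣ q) {X : Matrix (Fin g) (Fin g) ℤ}
    (hX : X.map (Int.castRingHom (ZMod q)) = 1) : X.map (Int.castRingHom (ZMod d)) = 1 := by
  rw [map_intCast_zmod_of_dvd_g52e h, hX, Matrix.map_one _ (map_zero _) (map_one _)]

/-- `X ≡ 0 (mod q) ⟹ X ≡ 0 (mod d)` for `d ∣ q`. [folklore] -/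
private theorem map_eq_zero_of_dvd_g52e {d q : ℕ} (h : d ∣ q) {X : Matrix (Fin g) (Fin g) ℤ}
    (hX : X.map (Int.castRingHom (ZMod q)) = 0) : X.map (Int.castRingHom (ZMod d)) = 0 := by
  rw [map_intCast_zmod_of_dvd_g52e h, hX, Matrix.map_zero _ (map_zero _)]

/-- `(1 + X) mod q`, `(X + Y) mod q`, products: bookkeeping for block congruences. [folklore] -/
private theorem map_add_g52e {q : ℕ} (X Y : Matrix (Fin g) (Fin g) ℤ) :
    (X + Y).map (Int.castRingHom (ZMod q)) = X.map (Int.castRingHom (ZMod q)) + Y.map (Int.castRingHom (ZMod q)) :=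
  Matrix.map_add _ (map_add (Int.castRingHom (ZMod q))) X Y

/-- `(−X) mod q = −(X mod q)`. [folklore] -/
private theorem map_neg_g52e {q : ℕ} (X : Matrix (Fin g) (Fin g) ℤ) :
    (-X).map (Int.castRingHom (ZMod q)) = -X.map (Int.castRingHom (ZMod q)) :=
  Matrix.map_neg _ (map_neg (Int.castRingHom (ZMod q))) X

/-- The blocks of a product in `Sp_{2g}(ℤ)`. [folklore] -/
private theorem coe_mul_eq_fromBlocks_g52e (a b : Matrix.symplecticGroup (Fin g) ℤ) :
    ((a * b : Matrix.symplecticGroup (Fin g) ℤ) : Matrix (Fin g ⊕ Fin g) (Fin g ⊕ Fin g) ℤ) =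
      Matrix.fromBlocks
        ((a : Matrix (Fin g ⊕ Fin g) (Fin g ⊕ Fin g) ℤ).toBlocks₁₁ * (b : Matrix (Fin g ⊕ Fin g) (Fin g ⊕ Fin g) ℤ).toBlocks₁₁ +
          (a : Matrix (Fin g ⊕ Fin g) (Fin g ⊕ Fin g) ℤ).toBlocks₁₂ * (b : Matrix (Fin g ⊕ Fin g) (Fin g ⊕ Fin g) ℤ).toBlocks₂₁)
        ((a : Matrix (Fin g ⊕ Fin g) (Fin g ⊕ Fin g) ℤ).toBlocks₁₁ * (b : Matrix (Fin g ⊕ Fin g) (Fin g ⊕ Fin g) ℤ).toBlocks₁₂ +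
          (a : Matrix (Fin g ⊕ Fin g) (Fin g ⊕ Fin g) ℤ).toBlocks₁₂ * (b : Matrix (Fin g ⊕ Fin g) (Fin g ⊕ Fin g) ℤ).toBlocks₂₂)
        ((a : Matrix (Fin g ⊕ Fin g) (Fin g ⊕ Fin g) ℤ).toBlocks₂₁ * (b : Matrix (Fin g ⊕ Fin g) (Fin g ⊕ Fin g) ℤ).toBlocks₁₁ +
          (a : Matrix (Fin g ⊕ Fin g) (Fin g ⊕ Fin g) ℤ).toBlocks₂₂ * (b : Matrix (Fin g ⊕ Fin g) (Fin g ⊕ Fin g) ℤ).toBlocks₂₁)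
        ((a : Matrix (Fin g ⊕ Fin g) (Fin g ⊕ Fin g) ℤ).toBlocks₂₁ * (b : Matrix (Fin g ⊕ Fin g) (Fin g ⊕ Fin g) ℤ).toBlocks₁₂ +
          (a : Matrix (Fin g ⊕ Fin g) (Fin g ⊕ Fin g) ℤ).toBlocks₂₂ * (b : Matrix (Fin g ⊕ Fin g) (Fin g ⊕ Fin g) ℤ).toBlocks₂₂) := by
  change (a : Matrix (Fin g ⊕ Fin g) (Fin g ⊕ Fin g) ℤ) * (b : Matrix (Fin g ⊕ Fin g) (Fin g ⊕ Fin g) ℤ) = _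
  conv_lhs => rw [← Matrix.fromBlocks_toBlocks (a : Matrix (Fin g ⊕ Fin g) (Fin g ⊕ Fin g) ℤ)]
  conv_lhs => rw [← Matrix.fromBlocks_toBlocks (b : Matrix (Fin g ⊕ Fin g) (Fin g ⊕ Fin g) ℤ)]
  rw [Matrix.fromBlocks_multiply]

/-- **`Γ_{2m}(2)` is closed under products** (the block congruences `A ≡ D ≡ I (mod 2)`, `B ≡ C ≡ 0 (mod 2m)` of
`β`, `β′` pass to `ββ′`; «does not yield a group unless `m` is even» — the level here is `2m`).
[cite: GoreskyTai2003RealModuli, §4.1 (definition of `Γ_{2m}(2)` and the remark following it)] -/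
theorem gammaTwoM_toBlocks_mul {m : ℕ} {β β' : Matrix.symplecticGroup (Fin g) ℤ}
    (hβ : (β : Matrix (Fin g ⊕ Fin g) (Fin g ⊕ Fin g) ℤ).toBlocks₁₁.map (Int.castRingHom (ZMod 2)) = 1 ∧
      (β : Matrix (Fin g ⊕ Fin g) (Fin g ⊕ Fin g) ℤ).toBlocks₂₂.map (Int.castRingHom (ZMod 2)) = 1 ∧
      (β : Matrix (Fin g ⊕ Fin g) (Fin g ⊕ Fin g) ℤ).toBlocks₁₂.map (Int.castRingHom (ZMod (2 * m))) = 0 ∧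
      (β : Matrix (Fin g ⊕ Fin g) (Fin g ⊕ Fin g) ℤ).toBlocks₂₁.map (Int.castRingHom (ZMod (2 * m))) = 0)
    (hβ' : (β' : Matrix (Fin g ⊕ Fin g) (Fin g ⊕ Fin g) ℤ).toBlocks₁₁.map (Int.castRingHom (ZMod 2)) = 1 ∧
      (β' : Matrix (Fin g ⊕ Fin g) (Fin g ⊕ Fin g) ℤ).toBlocks₂₂.map (Int.castRingHom (ZMod 2)) = 1 ∧
      (β' : Matrix (Fin g ⊕ Fin g) (Fin g ⊕ Fin g) ℤ).toBlocks₁₂.map (Int.castRingHom (ZMod (2 * m))) = 0 ∧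
      (β' : Matrix (Fin g ⊕ Fin g) (Fin g ⊕ Fin g) ℤ).toBlocks₂₁.map (Int.castRingHom (ZMod (2 * m))) = 0) :
    ((β * β' : Matrix.symplecticGroup (Fin g) ℤ) : Matrix (Fin g ⊕ Fin g) (Fin g ⊕ Fin g) ℤ).toBlocks₁₁.map
          (Int.castRingHom (ZMod 2)) = 1 ∧
      ((β * β' : Matrix.symplecticGroup (Fin g) ℤ) : Matrix (Fin g ⊕ Fin g) (Fin g ⊕ Fin g) ℤ).toBlocks₂₂.map
          (Int.castRingHom (ZMod 2)) = 1 ∧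
      ((β * β' : Matrix.symplecticGroup (Fin g) ℤ) : Matrix (Fin g ⊕ Fin g) (Fin g ⊕ Fin g) ℤ).toBlocks₁₂.map
          (Int.castRingHom (ZMod (2 * m))) = 0 ∧
      ((β * β' : Matrix.symplecticGroup (Fin g) ℤ) : Matrix (Fin g ⊕ Fin g) (Fin g ⊕ Fin g) ℤ).toBlocks₂₁.map
          (Int.castRingHom (ZMod (2 * m))) = 0 := by
  obtain ⟨hA, hD, hB, hC⟩ := hβ
  obtain ⟨hA', hD', hB', hC'⟩ := hβ'
  have h2 : 2 ∣ 2 * m := dvd_mul_right 2 m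
  rw [coe_mul_eq_fromBlocks_g52e, Matrix.toBlocks_fromBlocks₁₁, Matrix.toBlocks_fromBlocks₁₂,
    Matrix.toBlocks_fromBlocks₂₁, Matrix.toBlocks_fromBlocks₂₂]
  refine ⟨?_, ?_, ?_, ?_⟩
  · rw [map_add_g52e, Matrix.map_mul, Matrix.map_mul, hA, hA', map_eq_zero_of_dvd_g52e h2 hB, Matrix.one_mul,
      Matrix.zero_mul, add_zero]
  · rw [map_add_g52e, Matrix.map_mul, Matrix.map_mul, hD, hD', map_eq_zero_of_dvd_g52e h2 hC, Matrix.one_mul,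
      Matrix.zero_mul, zero_add]
  · rw [map_add_g52e, Matrix.map_mul, Matrix.map_mul, hB, hB', Matrix.mul_zero, Matrix.zero_mul, add_zero]
  · rw [map_add_g52e, Matrix.map_mul, Matrix.map_mul, hC, hC', Matrix.mul_zero, Matrix.zero_mul, add_zero]

/-- **`Γ_{2m}(2)` is closed under inverses** (`β⁻¹ = (ᵗD −ᵗB; −ᵗC ᵗA)`). [cite: GoreskyTai2003RealModuli, §4.1 and §2.1 (2.1)] -/
theorem gammaTwoM_toBlocks_inv {m : ℕ} {β : Matrix.symplecticGroup (Fin g) ℤ}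
    (hβ : (β : Matrix (Fin g ⊕ Fin g) (Fin g ⊕ Fin g) ℤ).toBlocks₁₁.map (Int.castRingHom (ZMod 2)) = 1 ∧
      (β : Matrix (Fin g ⊕ Fin g) (Fin g ⊕ Fin g) ℤ).toBlocks₂₂.map (Int.castRingHom (ZMod 2)) = 1 ∧
      (β : Matrix (Fin g ⊕ Fin g) (Fin g ⊕ Fin g) ℤ).toBlocks₁₂.map (Int.castRingHom (ZMod (2 * m))) = 0 ∧
      (β : Matrix (Fin g ⊕ Fin g) (Fin g ⊕ Fin g) ℤ).toBlocks₂₁.map (Int.castRingHom (ZMod (2 * m))) = 0) :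
    ((β⁻¹ : Matrix.symplecticGroup (Fin g) ℤ) : Matrix (Fin g ⊕ Fin g) (Fin g ⊕ Fin g) ℤ).toBlocks₁₁.map
          (Int.castRingHom (ZMod 2)) = 1 ∧
      ((β⁻¹ : Matrix.symplecticGroup (Fin g) ℤ) : Matrix (Fin g ⊕ Fin g) (Fin g ⊕ Fin g) ℤ).toBlocks₂₂.map
          (Int.castRingHom (ZMod 2)) = 1 ∧
      ((β⁻¹ : Matrix.symplecticGroup (Fin g) ℤ) : Matrix (Fin g ⊕ Fin g) (Fin g ⊕ Fin g) ℤ).toBlocks₁₂.map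
          (Int.castRingHom (ZMod (2 * m))) = 0 ∧
      ((β⁻¹ : Matrix.symplecticGroup (Fin g) ℤ) : Matrix (Fin g ⊕ Fin g) (Fin g ⊕ Fin g) ℤ).toBlocks₂₁.map
          (Int.castRingHom (ZMod (2 * m))) = 0 := by
  obtain ⟨hA, hD, hB, hC⟩ := hβ
  rw [coe_inv_eq_fromBlocks, Matrix.toBlocks_fromBlocks₁₁, Matrix.toBlocks_fromBlocks₁₂,
    Matrix.toBlocks_fromBlocks₂₁, Matrix.toBlocks_fromBlocks₂₂]
  refine ⟨?_, ?_, ?_, ?_⟩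
  · rw [Matrix.transpose_map, hD, Matrix.transpose_one]
  · rw [Matrix.transpose_map, hA, Matrix.transpose_one]
  · rw [map_neg_g52e, Matrix.transpose_map, hB, Matrix.transpose_zero, neg_zero]
  · rw [map_neg_g52e, Matrix.transpose_map, hC, Matrix.transpose_zero, neg_zero]

/-- **`Γ(2m) ⊆ Γ_{2m}(2)`** (so `Γ(4m) ⊆ Γ_{2m}(2)`: the left term of «`1 → Γ(4m) → Γ_{2m}(2) → …`»).
[cite: GoreskyTai2003RealModuli, §4.1 Lemma 7 (the exact sequence (4.1))] -/
theorem gammaTwoM_toBlocks_of_mem_siegelPrincipalGamma {m : ℕ} {γ : Matrix.symplecticGroup (Fin g) ℤ}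
    (hγ : γ ∈ siegelPrincipalGamma g (2 * m)) :
    (γ : Matrix (Fin g ⊕ Fin g) (Fin g ⊕ Fin g) ℤ).toBlocks₁₁.map (Int.castRingHom (ZMod 2)) = 1 ∧
      (γ : Matrix (Fin g ⊕ Fin g) (Fin g ⊕ Fin g) ℤ).toBlocks₂₂.map (Int.castRingHom (ZMod 2)) = 1 ∧
      (γ : Matrix (Fin g ⊕ Fin g) (Fin g ⊕ Fin g) ℤ).toBlocks₁₂.map (Int.castRingHom (ZMod (2 * m))) = 0 ∧
      (γ : Matrix (Fin g ⊕ Fin g) (Fin g ⊕ Fin g) ℤ).toBlocks₂₁.map (Int.castRingHom (ZMod (2 * m))) = 0 := by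
  have h2 : 2 ∣ 2 * m := dvd_mul_right 2 m
  rw [mem_siegelPrincipalGamma_iff, ← Matrix.fromBlocks_toBlocks (γ : Matrix (Fin g ⊕ Fin g) (Fin g ⊕ Fin g) ℤ),
    Matrix.fromBlocks_map, ← Matrix.fromBlocks_one, Matrix.fromBlocks_inj] at hγ
  obtain ⟨hA, hB, hC, hD⟩ := hγ
  exact ⟨map_eq_one_of_dvd_g52e h2 hA, map_eq_one_of_dvd_g52e h2 hD, hB, hC⟩

/-! ## §3 LEMMA 7, elementwise: the class map `β ↦ τ(β)β⁻¹`, `Γ_{2m}(2) → H¹(ℂ/ℝ, Γ(4m))` -/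

/-- **The class map is constant on double cosets `Γ(4m) β Γ_ℓ(2)` up to `Γ(4m)`-coboundaries**: for any
`δ, β ∈ Sp_{2g}(ℤ)` and block-diagonal `u = (P 0; 0 Q) ∈ Sp_{2g}(ℤ)`, `τ(δβu)(δβu)⁻¹ = τ(δ) · τ(β)β⁻¹ · δ⁻¹`
(the cocycle of `δβu` is the `δ`-twist `a ↦ τ(δ)aδ⁻¹` of the cocycle of `β`).
[cite: GoreskyTai2003RealModuli, §4.1 Lemma 7 and §4.2 (the map `H⁰(Γ(4m)\Γ_{2m}(2)) → H¹(Γ(4m))`)] -/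
theorem conjK_mk_mul_inv_of_mul_mul (δ β u : Matrix.symplecticGroup (Fin g) ℤ) {P Q : Matrix (Fin g) (Fin g) ℤ}
    (hu : (u : Matrix (Fin g ⊕ Fin g) (Fin g ⊕ Fin g) ℤ) = Matrix.fromBlocks P 0 0 Q) :
    (⟨Matrix.fromBlocks (-1 : Matrix (Fin g) (Fin g) ℤ) 0 0 (1 : Matrix (Fin g) (Fin g) ℤ) *
            ((δ * β * u : Matrix.symplecticGroup (Fin g) ℤ) : Matrix (Fin g ⊕ Fin g) (Fin g ⊕ Fin g) ℤ) *
            Matrix.fromBlocks (-1 : Matrix (Fin g) (Fin g) ℤ) 0 0 (1 : Matrix (Fin g) (Fin g) ℤ),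
          iStar_mul_mul_iStar_mem_symplecticGroup (δ * β * u).2⟩ : Matrix.symplecticGroup (Fin g) ℤ) * (δ * β * u)⁻¹ =
      (⟨Matrix.fromBlocks (-1 : Matrix (Fin g) (Fin g) ℤ) 0 0 (1 : Matrix (Fin g) (Fin g) ℤ) *
            (δ : Matrix (Fin g ⊕ Fin g) (Fin g ⊕ Fin g) ℤ) *
            Matrix.fromBlocks (-1 : Matrix (Fin g) (Fin g) ℤ) 0 0 (1 : Matrix (Fin g) (Fin g) ℤ),
          iStar_mul_mul_iStar_mem_symplecticGroup δ.2⟩ : Matrix.symplecticGroup (Fin g) ℤ) *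
        ((⟨Matrix.fromBlocks (-1 : Matrix (Fin g) (Fin g) ℤ) 0 0 (1 : Matrix (Fin g) (Fin g) ℤ) *
              (β : Matrix (Fin g ⊕ Fin g) (Fin g ⊕ Fin g) ℤ) *
              Matrix.fromBlocks (-1 : Matrix (Fin g) (Fin g) ℤ) 0 0 (1 : Matrix (Fin g) (Fin g) ℤ),
            iStar_mul_mul_iStar_mem_symplecticGroup β.2⟩ : Matrix.symplecticGroup (Fin g) ℤ) * β⁻¹) * δ⁻¹ := by
  rw [← conjK_mul_inv_mul_eq_of_coe_eq_fromBlocks β u hu, mul_assoc δ β u, conjK_mk_mul, _root_.mul_inv_rev]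
  simp only [mul_assoc]

/-- **INJECTIVITY of `Γ(4m)\Γ_{2m}(2)/Γ_ℓ(2) → H¹(ℂ/ℝ, Γ(4m))`**: if `β, β′ ∈ Γ_{2m}(2)` have `Γ(4m)`-cohomologous
classes, `τ(β′)β′⁻¹ = τ(δ) · τ(β)β⁻¹ · δ⁻¹` with `δ ∈ Γ(4m)`, then `β′ = δβα` with `α = (P 0; 0 Q)`, `ᵗPQ = 1`,
`P ≡ Q ≡ I (mod 2)`, i.e. `α ∈ Γ_ℓ(2)` («`GL_n ∩ Γ_{2m}(2) = Γ_ℓ(2)`»): `τ` fixes `(δβ)⁻¹β′ ∈ Γ_{2m}(2)`.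
[cite: GoreskyTai2003RealModuli, §4.1 Lemma 7, §4.2 and §4.5 («`τ(g₂⁻¹γg₁) = g₂⁻¹γg₁` which implies that `g₂⁻¹γg₁ ∈ GL_n(ℝ) ∩ Γ_{2m}(2) = Γ_ℓ(2)`»)] -/
theorem exists_eq_mul_mul_fromBlocks_of_conjK_mk_mul_inv_eq {m : ℕ} {β β' δ : Matrix.symplecticGroup (Fin g) ℤ}
    (hβ : (β : Matrix (Fin g ⊕ Fin g) (Fin g ⊕ Fin g) ℤ).toBlocks₁₁.map (Int.castRingHom (ZMod 2)) = 1 ∧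
      (β : Matrix (Fin g ⊕ Fin g) (Fin g ⊕ Fin g) ℤ).toBlocks₂₂.map (Int.castRingHom (ZMod 2)) = 1 ∧
      (β : Matrix (Fin g ⊕ Fin g) (Fin g ⊕ Fin g) ℤ).toBlocks₁₂.map (Int.castRingHom (ZMod (2 * m))) = 0 ∧
      (β : Matrix (Fin g ⊕ Fin g) (Fin g ⊕ Fin g) ℤ).toBlocks₂₁.map (Int.castRingHom (ZMod (2 * m))) = 0)
    (hβ' : (β' : Matrix (Fin g ⊕ Fin g) (Fin g ⊕ Fin g) ℤ).toBlocks₁₁.map (Int.castRingHom (ZMod 2)) = 1 ∧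
      (β' : Matrix (Fin g ⊕ Fin g) (Fin g ⊕ Fin g) ℤ).toBlocks₂₂.map (Int.castRingHom (ZMod 2)) = 1 ∧
      (β' : Matrix (Fin g ⊕ Fin g) (Fin g ⊕ Fin g) ℤ).toBlocks₁₂.map (Int.castRingHom (ZMod (2 * m))) = 0 ∧
      (β' : Matrix (Fin g ⊕ Fin g) (Fin g ⊕ Fin g) ℤ).toBlocks₂₁.map (Int.castRingHom (ZMod (2 * m))) = 0)
    (hδ : δ ∈ siegelPrincipalGamma g (4 * m))
    (h : (⟨Matrix.fromBlocks (-1 : Matrix (Fin g) (Fin g) ℤ) 0 0 (1 : Matrix (Fin g) (Fin g) ℤ) *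
              (β' : Matrix (Fin g ⊕ Fin g) (Fin g ⊕ Fin g) ℤ) *
              Matrix.fromBlocks (-1 : Matrix (Fin g) (Fin g) ℤ) 0 0 (1 : Matrix (Fin g) (Fin g) ℤ),
            iStar_mul_mul_iStar_mem_symplecticGroup β'.2⟩ : Matrix.symplecticGroup (Fin g) ℤ) * β'⁻¹ =
      (⟨Matrix.fromBlocks (-1 : Matrix (Fin g) (Fin g) ℤ) 0 0 (1 : Matrix (Fin g) (Fin g) ℤ) *
            (δ : Matrix (Fin g ⊕ Fin g) (Fin g ⊕ Fin g) ℤ) *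
            Matrix.fromBlocks (-1 : Matrix (Fin g) (Fin g) ℤ) 0 0 (1 : Matrix (Fin g) (Fin g) ℤ),
          iStar_mul_mul_iStar_mem_symplecticGroup δ.2⟩ : Matrix.symplecticGroup (Fin g) ℤ) *
        ((⟨Matrix.fromBlocks (-1 : Matrix (Fin g) (Fin g) ℤ) 0 0 (1 : Matrix (Fin g) (Fin g) ℤ) *
              (β : Matrix (Fin g ⊕ Fin g) (Fin g ⊕ Fin g) ℤ) *
              Matrix.fromBlocks (-1 : Matrix (Fin g) (Fin g) ℤ) 0 0 (1 : Matrix (Fin g) (Fin g) ℤ),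
            iStar_mul_mul_iStar_mem_symplecticGroup β.2⟩ : Matrix.symplecticGroup (Fin g) ℤ) * β⁻¹) * δ⁻¹) :
    ∃ P Q : Matrix (Fin g) (Fin g) ℤ, Pᵀ * Q = 1 ∧ P.map (Int.castRingHom (ZMod 2)) = 1 ∧
      Q.map (Int.castRingHom (ZMod 2)) = 1 ∧
      (β' : Matrix (Fin g ⊕ Fin g) (Fin g ⊕ Fin g) ℤ) =
        (δ : Matrix (Fin g ⊕ Fin g) (Fin g ⊕ Fin g) ℤ) * (β : Matrix (Fin g ⊕ Fin g) (Fin g ⊕ Fin g) ℤ) *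
          Matrix.fromBlocks P 0 0 Q := by
  -- `τ(δ)·τ(β)β⁻¹·δ⁻¹ = τ(δβ)(δβ)⁻¹`
  have h1 : (⟨Matrix.fromBlocks (-1 : Matrix (Fin g) (Fin g) ℤ) 0 0 (1 : Matrix (Fin g) (Fin g) ℤ) *
              (β' : Matrix (Fin g ⊕ Fin g) (Fin g ⊕ Fin g) ℤ) *
              Matrix.fromBlocks (-1 : Matrix (Fin g) (Fin g) ℤ) 0 0 (1 : Matrix (Fin g) (Fin g) ℤ),
            iStar_mul_mul_iStar_mem_symplecticGroup β'.2⟩ : Matrix.symplecticGroup (Fin g) ℤ) * β'⁻¹ =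
      (⟨Matrix.fromBlocks (-1 : Matrix (Fin g) (Fin g) ℤ) 0 0 (1 : Matrix (Fin g) (Fin g) ℤ) *
            ((δ * β : Matrix.symplecticGroup (Fin g) ℤ) : Matrix (Fin g ⊕ Fin g) (Fin g ⊕ Fin g) ℤ) *
            Matrix.fromBlocks (-1 : Matrix (Fin g) (Fin g) ℤ) 0 0 (1 : Matrix (Fin g) (Fin g) ℤ),
          iStar_mul_mul_iStar_mem_symplecticGroup (δ * β).2⟩ : Matrix.symplecticGroup (Fin g) ℤ) * (δ * β)⁻¹ := by
    rw [h, conjK_mk_mul, _root_.mul_inv_rev]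
    simp only [mul_assoc]
  -- so `τ` fixes `v = (δβ)⁻¹β′`
  have hv := (conjK_mk_mul_inv_eq_conjK_mk_mul_inv_iff β' (δ * β)).1 h1
  have hvmat := (conjK_mul_mul_conjK_eq_self_iff _).1 (congrArg Subtype.val hv)
  -- `v ∈ Γ_{2m}(2)`
  have h24 : 2 * m ∣ 4 * m := ⟨2, by ring⟩
  have hvΓ := gammaTwoM_toBlocks_mul (gammaTwoM_toBlocks_inv (gammaTwoM_toBlocks_mul
    (gammaTwoM_toBlocks_of_mem_siegelPrincipalGamma (siegelPrincipalGamma_anti h24 hδ)) hβ)) hβ'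
  obtain ⟨hP, hQ, -, -⟩ := hvΓ
  have hvbl : (((δ * β)⁻¹ * β' : Matrix.symplecticGroup (Fin g) ℤ) : Matrix (Fin g ⊕ Fin g) (Fin g ⊕ Fin g) ℤ) =
      Matrix.fromBlocks (((δ * β)⁻¹ * β' : Matrix.symplecticGroup (Fin g) ℤ) : Matrix (Fin g ⊕ Fin g) (Fin g ⊕ Fin g) ℤ).toBlocks₁₁
        0 0 (((δ * β)⁻¹ * β' : Matrix.symplecticGroup (Fin g) ℤ) : Matrix (Fin g ⊕ Fin g) (Fin g ⊕ Fin g) ℤ).toBlocks₂₂ := by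
    conv_lhs => rw [← Matrix.fromBlocks_toBlocks
      (((δ * β)⁻¹ * β' : Matrix.symplecticGroup (Fin g) ℤ) : Matrix (Fin g ⊕ Fin g) (Fin g ⊕ Fin g) ℤ)]
    rw [hvmat.1, hvmat.2]
  refine ⟨_, _, ?_, hP, hQ, ?_⟩
  · rw [← fromBlocks_zero_zero_mem_symplecticGroup_iff, ← hvbl]
    exact ((δ * β)⁻¹ * β').2
  · rw [← hvbl]
    change (β' : Matrix (Fin g ⊕ Fin g) (Fin g ⊕ Fin g) ℤ) =
      ((δ * β * ((δ * β)⁻¹ * β') : Matrix.symplecticGroup (Fin g) ℤ) : Matrix (Fin g ⊕ Fin g) (Fin g ⊕ Fin g) ℤ)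
    rw [mul_inv_cancel_left]

/-- **SURJECTIVITY: «`H¹(ℂ/ℝ, Γ(4m)) → H¹(ℂ/ℝ, Γ_{2m}(2))` is trivial»** (`g ≥ 1`, `m ≥ 1`): every cocycle
`γ ∈ Γ_g(4m)`, `τ(γ)γ = 1`, is `τ(β)β⁻¹` for some `β ∈ Γ_{2m}(2)`, and then `𝔥_g^γ = β · iC_g` («if `f_γ` is a
1-cocycle then by Proposition 6, `𝔥_n^γ ≠ ∅`.  Then Proposition 11 implies that `γ = g̃g⁻¹` for some
`g ∈ Γ_{2m}(2)`»: Prop. 1 of g52-#1 supplies the real point, Cor. 11 of g52-#4 the element `β`).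
[cite: GoreskyTai2003RealModuli, §4.2 proof of Lemma 7 (first claim)] -/
theorem exists_gammaTwoM_eq_conjK_mul_inv_of_conjK_mul_self_eq_one (hg : 0 < g) {m : ℕ} (hm : 0 < m)
    {γ : Matrix.symplecticGroup (Fin g) ℤ} (hγ : γ ∈ siegelPrincipalGamma g (4 * m))
    (hcoc : (⟨Matrix.fromBlocks (-1 : Matrix (Fin g) (Fin g) ℤ) 0 0 (1 : Matrix (Fin g) (Fin g) ℤ) *
            (γ : Matrix (Fin g ⊕ Fin g) (Fin g ⊕ Fin g) ℤ) *
            Matrix.fromBlocks (-1 : Matrix (Fin g) (Fin g) ℤ) 0 0 (1 : Matrix (Fin g) (Fin g) ℤ),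
          iStar_mul_mul_iStar_mem_symplecticGroup γ.2⟩ : Matrix.symplecticGroup (Fin g) ℤ) * γ = 1) :
    ∃ β : Matrix.symplecticGroup (Fin g) ℤ,
      ((β : Matrix (Fin g ⊕ Fin g) (Fin g ⊕ Fin g) ℤ).toBlocks₁₁.map (Int.castRingHom (ZMod 2)) = 1 ∧
        (β : Matrix (Fin g ⊕ Fin g) (Fin g ⊕ Fin g) ℤ).toBlocks₂₂.map (Int.castRingHom (ZMod 2)) = 1 ∧
        (β : Matrix (Fin g ⊕ Fin g) (Fin g ⊕ Fin g) ℤ).toBlocks₁₂.map (Int.castRingHom (ZMod (2 * m))) = 0 ∧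
        (β : Matrix (Fin g ⊕ Fin g) (Fin g ⊕ Fin g) ℤ).toBlocks₂₁.map (Int.castRingHom (ZMod (2 * m))) = 0) ∧
      γ = (⟨Matrix.fromBlocks (-1 : Matrix (Fin g) (Fin g) ℤ) 0 0 (1 : Matrix (Fin g) (Fin g) ℤ) *
              (β : Matrix (Fin g ⊕ Fin g) (Fin g ⊕ Fin g) ℤ) *
              Matrix.fromBlocks (-1 : Matrix (Fin g) (Fin g) ℤ) 0 0 (1 : Matrix (Fin g) (Fin g) ℤ),
            iStar_mul_mul_iStar_mem_symplecticGroup β.2⟩ : Matrix.symplecticGroup (Fin g) ℤ) * β⁻¹ ∧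
      ∀ Ω : siegelUpperHalfSpace g,
        symplecticIntHom g γ • Ω = ⟨-(Ω : Matrix (Fin g) (Fin g) ℂ).map conj, neg_map_conj_mem_siegelUpperHalfSpace Ω.2⟩ ↔
          (((symplecticIntHom g β)⁻¹ • Ω : siegelUpperHalfSpace g) : Matrix (Fin g) (Fin g) ℂ).map Complex.re = 0 := by
  have hcocR : (⟨Matrix.fromBlocks (-1 : Matrix (Fin g) (Fin g) ℝ) 0 0 (1 : Matrix (Fin g) (Fin g) ℝ) *
          ((symplecticIntHom g γ : Matrix.symplecticGroup (Fin g) ℝ) : Matrix (Fin g ⊕ Fin g) (Fin g ⊕ Fin g) ℝ) *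
          Matrix.fromBlocks (-1 : Matrix (Fin g) (Fin g) ℝ) 0 0 (1 : Matrix (Fin g) (Fin g) ℝ),
        iStar_mul_mul_iStar_mem_symplecticGroup (symplecticIntHom g γ).2⟩ : Matrix.symplecticGroup (Fin g) ℝ) *
        symplecticIntHom g γ = 1 := by
    rw [iStarConj_symplecticIntHom_mul_self, hcoc, map_one]
  exact exists_gammaTwoM_eq_conjK_mul_inv_of_mem_siegelPrincipalGamma_four_mul hg hm hγ
    (exists_smul_eq_negConj_of_iStar_mul_self_eq_one _ hcocR)

/-! ## §4 LEMMA 12 -/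

/-- **LEMMA 12 (Goresky–Tai).**  «Let `g₁, g₂ ∈ Γ_{2m}(2)`.  Suppose there exist `Z₁ ∈ g₁iC_n`, `Z₂ ∈ g₂iC_n`,
and `γ ∈ Γ(4m)` such that `γZ₁ = Z₂`.  Then there exist `α ∈ Γ_ℓ(2)` such that `g₂ = γg₁α`.»  Here (`m ≥ 1`;
`Z ∈ g · iC_g ⟺ Re(g⁻¹ • Z) = 0`; `α = (P 0; 0 Q)` with `ᵗPQ = 1`, `P ≡ Q ≡ I (mod 2)`).  Proof as printed:
`θ = (g̃₁g₁⁻¹)⁻¹ γ̃⁻¹ (g̃₂g₂⁻¹) γ` lies in `Γ(4m)` (Lemma 9 (3), `τ`-stability of `Γ(4m)`) and fixes `Z₁`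
(`γZ₁ = Z₂`, `g̃₂g₂⁻¹Z₂ = τZ₂`, `γ̃⁻¹τZ₂ = τ(γ⁻¹Z₂) = τZ₁`, `(g̃₁g₁⁻¹)⁻¹τZ₁ = Z₁`); `Γ(4m)` acts freely, so
`θ = 1`, whence `τ(g₁⁻¹γ⁻¹g₂) = g₁⁻¹γ⁻¹g₂ =: α` is block diagonal and lies in `Γ_{2m}(2)`, i.e. `α ∈ Γ_ℓ(2)`.
[cite: GoreskyTai2003RealModuli, §4.5 Lemma 12 and its proof] -/
theorem exists_eq_mul_mul_fromBlocks_of_smul_eq {m : ℕ} (hm : 0 < m) {g₁ g₂ γ : Matrix.symplecticGroup (Fin g) ℤ}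
    (hg₁ : (g₁ : Matrix (Fin g ⊕ Fin g) (Fin g ⊕ Fin g) ℤ).toBlocks₁₁.map (Int.castRingHom (ZMod 2)) = 1 ∧
      (g₁ : Matrix (Fin g ⊕ Fin g) (Fin g ⊕ Fin g) ℤ).toBlocks₂₂.map (Int.castRingHom (ZMod 2)) = 1 ∧
      (g₁ : Matrix (Fin g ⊕ Fin g) (Fin g ⊕ Fin g) ℤ).toBlocks₁₂.map (Int.castRingHom (ZMod (2 * m))) = 0 ∧
      (g₁ : Matrix (Fin g ⊕ Fin g) (Fin g ⊕ Fin g) ℤ).toBlocks₂₁.map (Int.castRingHom (ZMod (2 * m))) = 0)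
    (hg₂ : (g₂ : Matrix (Fin g ⊕ Fin g) (Fin g ⊕ Fin g) ℤ).toBlocks₁₁.map (Int.castRingHom (ZMod 2)) = 1 ∧
      (g₂ : Matrix (Fin g ⊕ Fin g) (Fin g ⊕ Fin g) ℤ).toBlocks₂₂.map (Int.castRingHom (ZMod 2)) = 1 ∧
      (g₂ : Matrix (Fin g ⊕ Fin g) (Fin g ⊕ Fin g) ℤ).toBlocks₁₂.map (Int.castRingHom (ZMod (2 * m))) = 0 ∧
      (g₂ : Matrix (Fin g ⊕ Fin g) (Fin g ⊕ Fin g) ℤ).toBlocks₂₁.map (Int.castRingHom (ZMod (2 * m))) = 0)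
    (hγ : γ ∈ siegelPrincipalGamma g (4 * m)) {Z₁ Z₂ : siegelUpperHalfSpace g}
    (hZ₁ : (((symplecticIntHom g g₁)⁻¹ • Z₁ : siegelUpperHalfSpace g) : Matrix (Fin g) (Fin g) ℂ).map Complex.re = 0)
    (hZ₂ : (((symplecticIntHom g g₂)⁻¹ • Z₂ : siegelUpperHalfSpace g) : Matrix (Fin g) (Fin g) ℂ).map Complex.re = 0)
    (hγZ : symplecticIntHom g γ • Z₁ = Z₂) :
    ∃ P Q : Matrix (Fin g) (Fin g) ℤ, Pᵀ * Q = 1 ∧ P.map (Int.castRingHom (ZMod 2)) = 1 ∧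
      Q.map (Int.castRingHom (ZMod 2)) = 1 ∧
      (g₂ : Matrix (Fin g ⊕ Fin g) (Fin g ⊕ Fin g) ℤ) =
        (γ : Matrix (Fin g ⊕ Fin g) (Fin g ⊕ Fin g) ℤ) * (g₁ : Matrix (Fin g ⊕ Fin g) (Fin g ⊕ Fin g) ℤ) *
          Matrix.fromBlocks P 0 0 Q := by
  have hq : 3 ≤ 4 * m := by omega
  -- the three factors of `θ` lie in `Γ(4m)`
  have ht₁ := conjK_mul_inv_mem_siegelPrincipalGamma_of_toBlocks hg₁.2.2.1 hg₁.2.2.2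
  have ht₂ := conjK_mul_inv_mem_siegelPrincipalGamma_of_toBlocks hg₂.2.2.1 hg₂.2.2.2
  have hk := conjK_mul_mul_conjK_mem_siegelPrincipalGamma hγ
  have hθmem : ((⟨Matrix.fromBlocks (-1 : Matrix (Fin g) (Fin g) ℤ) 0 0 (1 : Matrix (Fin g) (Fin g) ℤ) *
            (g₁ : Matrix (Fin g ⊕ Fin g) (Fin g ⊕ Fin g) ℤ) *
            Matrix.fromBlocks (-1 : Matrix (Fin g) (Fin g) ℤ) 0 0 (1 : Matrix (Fin g) (Fin g) ℤ),
          iStar_mul_mul_iStar_mem_symplecticGroup g₁.2⟩ : Matrix.symplecticGroup (Fin g) ℤ) * g₁⁻¹)⁻¹ *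
        (⟨Matrix.fromBlocks (-1 : Matrix (Fin g) (Fin g) ℤ) 0 0 (1 : Matrix (Fin g) (Fin g) ℤ) *
            (γ : Matrix (Fin g ⊕ Fin g) (Fin g ⊕ Fin g) ℤ) *
            Matrix.fromBlocks (-1 : Matrix (Fin g) (Fin g) ℤ) 0 0 (1 : Matrix (Fin g) (Fin g) ℤ),
          iStar_mul_mul_iStar_mem_symplecticGroup γ.2⟩ : Matrix.symplecticGroup (Fin g) ℤ)⁻¹ *
        ((⟨Matrix.fromBlocks (-1 : Matrix (Fin g) (Fin g) ℤ) 0 0 (1 : Matrix (Fin g) (Fin g) ℤ) *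
            (g₂ : Matrix (Fin g ⊕ Fin g) (Fin g ⊕ Fin g) ℤ) *
            Matrix.fromBlocks (-1 : Matrix (Fin g) (Fin g) ℤ) 0 0 (1 : Matrix (Fin g) (Fin g) ℤ),
          iStar_mul_mul_iStar_mem_symplecticGroup g₂.2⟩ : Matrix.symplecticGroup (Fin g) ℤ) * g₂⁻¹) * γ ∈
      siegelPrincipalGamma g (4 * m) :=
    Subgroup.mul_mem _ (Subgroup.mul_mem _ (Subgroup.mul_mem _ (Subgroup.inv_mem _ ht₁) (Subgroup.inv_mem _ hk)) ht₂) hγ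
  -- `θ` fixes `Z₁`
  have hZ₁' := (smul_eq_negConj_iff_of_coboundary (symplecticIntHom g g₁) Z₁).2 hZ₁
  have hZ₂' := (smul_eq_negConj_iff_of_coboundary (symplecticIntHom g g₂) Z₂).2 hZ₂
  have hγ' : (symplecticIntHom g γ)⁻¹ • Z₂ = Z₁ := by
    rw [inv_smul_eq_iff, hγZ]
  have hτγ : (⟨Matrix.fromBlocks (-1 : Matrix (Fin g) (Fin g) ℝ) 0 0 (1 : Matrix (Fin g) (Fin g) ℝ) *
          ((symplecticIntHom g γ : Matrix.symplecticGroup (Fin g) ℝ) : Matrix (Fin g ⊕ Fin g) (Fin g ⊕ Fin g) ℝ) *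
          Matrix.fromBlocks (-1 : Matrix (Fin g) (Fin g) ℝ) 0 0 (1 : Matrix (Fin g) (Fin g) ℝ),
        iStar_mul_mul_iStar_mem_symplecticGroup (symplecticIntHom g γ).2⟩ : Matrix.symplecticGroup (Fin g) ℝ)⁻¹ •
        (⟨-(Z₂ : Matrix (Fin g) (Fin g) ℂ).map conj, neg_map_conj_mem_siegelUpperHalfSpace Z₂.2⟩ : siegelUpperHalfSpace g) =
      ⟨-(Z₁ : Matrix (Fin g) (Fin g) ℂ).map conj, neg_map_conj_mem_siegelUpperHalfSpace Z₁.2⟩ := by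
    rw [← iStarConj_inv, iStar_smul_negConj, hγ']
  have hfix : symplecticIntHom g (((⟨Matrix.fromBlocks (-1 : Matrix (Fin g) (Fin g) ℤ) 0 0 (1 : Matrix (Fin g) (Fin g) ℤ) *
            (g₁ : Matrix (Fin g ⊕ Fin g) (Fin g ⊕ Fin g) ℤ) *
            Matrix.fromBlocks (-1 : Matrix (Fin g) (Fin g) ℤ) 0 0 (1 : Matrix (Fin g) (Fin g) ℤ),
          iStar_mul_mul_iStar_mem_symplecticGroup g₁.2⟩ : Matrix.symplecticGroup (Fin g) ℤ) * g₁⁻¹)⁻¹ *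
        (⟨Matrix.fromBlocks (-1 : Matrix (Fin g) (Fin g) ℤ) 0 0 (1 : Matrix (Fin g) (Fin g) ℤ) *
            (γ : Matrix (Fin g ⊕ Fin g) (Fin g ⊕ Fin g) ℤ) *
            Matrix.fromBlocks (-1 : Matrix (Fin g) (Fin g) ℤ) 0 0 (1 : Matrix (Fin g) (Fin g) ℤ),
          iStar_mul_mul_iStar_mem_symplecticGroup γ.2⟩ : Matrix.symplecticGroup (Fin g) ℤ)⁻¹ *
        ((⟨Matrix.fromBlocks (-1 : Matrix (Fin g) (Fin g) ℤ) 0 0 (1 : Matrix (Fin g) (Fin g) ℤ) *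
            (g₂ : Matrix (Fin g ⊕ Fin g) (Fin g ⊕ Fin g) ℤ) *
            Matrix.fromBlocks (-1 : Matrix (Fin g) (Fin g) ℤ) 0 0 (1 : Matrix (Fin g) (Fin g) ℤ),
          iStar_mul_mul_iStar_mem_symplecticGroup g₂.2⟩ : Matrix.symplecticGroup (Fin g) ℤ) * g₂⁻¹) * γ) • Z₁ = Z₁ := by
    simp only [map_mul, map_inv, symplecticIntHom_conjK]
    rw [mul_smul, mul_smul, mul_smul, hγZ, hZ₂', hτγ, inv_smul_eq_iff]
    exact hZ₁'.symm
  have hθ := eq_one_of_smul_eq_self_of_mem_siegelPrincipalGamma hq hθmem hfix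
  -- hence `τ(α) = α` for `α = g₁⁻¹γ⁻¹g₂`
  have hα : (⟨Matrix.fromBlocks (-1 : Matrix (Fin g) (Fin g) ℤ) 0 0 (1 : Matrix (Fin g) (Fin g) ℤ) *
          ((g₁⁻¹ * γ⁻¹ * g₂ : Matrix.symplecticGroup (Fin g) ℤ) : Matrix (Fin g ⊕ Fin g) (Fin g ⊕ Fin g) ℤ) *
          Matrix.fromBlocks (-1 : Matrix (Fin g) (Fin g) ℤ) 0 0 (1 : Matrix (Fin g) (Fin g) ℤ),
        iStar_mul_mul_iStar_mem_symplecticGroup (g₁⁻¹ * γ⁻¹ * g₂).2⟩ : Matrix.symplecticGroup (Fin g) ℤ) =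
      g₁⁻¹ * γ⁻¹ * g₂ := by
    rw [conjK_mk_mul, conjK_mk_mul, conjK_mk_inv, conjK_mk_inv]
    calc (⟨Matrix.fromBlocks (-1 : Matrix (Fin g) (Fin g) ℤ) 0 0 (1 : Matrix (Fin g) (Fin g) ℤ) *
              (g₁ : Matrix (Fin g ⊕ Fin g) (Fin g ⊕ Fin g) ℤ) *
              Matrix.fromBlocks (-1 : Matrix (Fin g) (Fin g) ℤ) 0 0 (1 : Matrix (Fin g) (Fin g) ℤ),
            iStar_mul_mul_iStar_mem_symplecticGroup g₁.2⟩ : Matrix.symplecticGroup (Fin g) ℤ)⁻¹ *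
          (⟨Matrix.fromBlocks (-1 : Matrix (Fin g) (Fin g) ℤ) 0 0 (1 : Matrix (Fin g) (Fin g) ℤ) *
              (γ : Matrix (Fin g ⊕ Fin g) (Fin g ⊕ Fin g) ℤ) *
              Matrix.fromBlocks (-1 : Matrix (Fin g) (Fin g) ℤ) 0 0 (1 : Matrix (Fin g) (Fin g) ℤ),
            iStar_mul_mul_iStar_mem_symplecticGroup γ.2⟩ : Matrix.symplecticGroup (Fin g) ℤ)⁻¹ *
          (⟨Matrix.fromBlocks (-1 : Matrix (Fin g) (Fin g) ℤ) 0 0 (1 : Matrix (Fin g) (Fin g) ℤ) *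
              (g₂ : Matrix (Fin g ⊕ Fin g) (Fin g ⊕ Fin g) ℤ) *
              Matrix.fromBlocks (-1 : Matrix (Fin g) (Fin g) ℤ) 0 0 (1 : Matrix (Fin g) (Fin g) ℤ),
            iStar_mul_mul_iStar_mem_symplecticGroup g₂.2⟩ : Matrix.symplecticGroup (Fin g) ℤ)
        = g₁⁻¹ * (((⟨Matrix.fromBlocks (-1 : Matrix (Fin g) (Fin g) ℤ) 0 0 (1 : Matrix (Fin g) (Fin g) ℤ) *
              (g₁ : Matrix (Fin g ⊕ Fin g) (Fin g ⊕ Fin g) ℤ) *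
              Matrix.fromBlocks (-1 : Matrix (Fin g) (Fin g) ℤ) 0 0 (1 : Matrix (Fin g) (Fin g) ℤ),
            iStar_mul_mul_iStar_mem_symplecticGroup g₁.2⟩ : Matrix.symplecticGroup (Fin g) ℤ) * g₁⁻¹)⁻¹ *
          (⟨Matrix.fromBlocks (-1 : Matrix (Fin g) (Fin g) ℤ) 0 0 (1 : Matrix (Fin g) (Fin g) ℤ) *
              (γ : Matrix (Fin g ⊕ Fin g) (Fin g ⊕ Fin g) ℤ) *
              Matrix.fromBlocks (-1 : Matrix (Fin g) (Fin g) ℤ) 0 0 (1 : Matrix (Fin g) (Fin g) ℤ),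
            iStar_mul_mul_iStar_mem_symplecticGroup γ.2⟩ : Matrix.symplecticGroup (Fin g) ℤ)⁻¹ *
          ((⟨Matrix.fromBlocks (-1 : Matrix (Fin g) (Fin g) ℤ) 0 0 (1 : Matrix (Fin g) (Fin g) ℤ) *
              (g₂ : Matrix (Fin g ⊕ Fin g) (Fin g ⊕ Fin g) ℤ) *
              Matrix.fromBlocks (-1 : Matrix (Fin g) (Fin g) ℤ) 0 0 (1 : Matrix (Fin g) (Fin g) ℤ),
            iStar_mul_mul_iStar_mem_symplecticGroup g₂.2⟩ : Matrix.symplecticGroup (Fin g) ℤ) * g₂⁻¹) * γ) * γ⁻¹ * g₂ := by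
          group
      _ = g₁⁻¹ * γ⁻¹ * g₂ := by rw [hθ]; group
  have hαmat := (conjK_mul_mul_conjK_eq_self_iff _).1 (congrArg Subtype.val hα)
  -- `α ∈ Γ_{2m}(2)`
  have h24 : 2 * m ∣ 4 * m := ⟨2, by ring⟩
  have hαΓ := gammaTwoM_toBlocks_mul (gammaTwoM_toBlocks_mul (gammaTwoM_toBlocks_inv hg₁)
    (gammaTwoM_toBlocks_of_mem_siegelPrincipalGamma (siegelPrincipalGamma_anti h24 (Subgroup.inv_mem _ hγ)))) hg₂
  obtain ⟨hP, hQ, -, -⟩ := hαΓ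
  have hαbl : ((g₁⁻¹ * γ⁻¹ * g₂ : Matrix.symplecticGroup (Fin g) ℤ) : Matrix (Fin g ⊕ Fin g) (Fin g ⊕ Fin g) ℤ) =
      Matrix.fromBlocks ((g₁⁻¹ * γ⁻¹ * g₂ : Matrix.symplecticGroup (Fin g) ℤ) : Matrix (Fin g ⊕ Fin g) (Fin g ⊕ Fin g) ℤ).toBlocks₁₁
        0 0 ((g₁⁻¹ * γ⁻¹ * g₂ : Matrix.symplecticGroup (Fin g) ℤ) : Matrix (Fin g ⊕ Fin g) (Fin g ⊕ Fin g) ℤ).toBlocks₂₂ := by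
    conv_lhs => rw [← Matrix.fromBlocks_toBlocks
      ((g₁⁻¹ * γ⁻¹ * g₂ : Matrix.symplecticGroup (Fin g) ℤ) : Matrix (Fin g ⊕ Fin g) (Fin g ⊕ Fin g) ℤ)]
    rw [hαmat.1, hαmat.2]
  refine ⟨_, _, ?_, hP, hQ, ?_⟩
  · rw [← fromBlocks_zero_zero_mem_symplecticGroup_iff, ← hαbl]
    exact (g₁⁻¹ * γ⁻¹ * g₂).2
  · rw [← hαbl]
    change (g₂ : Matrix (Fin g ⊕ Fin g) (Fin g ⊕ Fin g) ℤ) =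
      ((γ * g₁ * (g₁⁻¹ * γ⁻¹ * g₂) : Matrix.symplecticGroup (Fin g) ℤ) : Matrix (Fin g ⊕ Fin g) (Fin g ⊕ Fin g) ℤ)
    congr 1
    group

end SiegelModuli

end Literature.AlgebraicGeometry.ModuliOfAbelianVarieties
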